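import Literature.IUT.HodgeTheaters.FrobenioidBridgeModelsEx54ivInfKappa
import Literature.IUT.HodgeTheaters.FrobenioidBridgeModelsEx54ivProofs
import HarnessLib

/-!
# [IUTchI] Example 5.4 (iv), p. 149 ll. 3–31 — the typed `∞κ`-compatibility clause is CONSISTENT and has CONTENT:
# non-vacuity of `InfKappaLink` + `Ex54ivInfKappaCompat` over every stub, and failure of its universal closure
# (cell abc-iut, seat abc-iut-L5-t9 gen 8, row EX54IV sequel; PROOF-ONLY)

S. Mochizuki, *Inter-universal Teichmüller theory I*, kurims manuscript (May 2020), Example 5.4 (iv) p. 149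
([IUTchI] Ex 5.4 (iv) p.149) [claim: Mochizuki2012, status: disputed] (D-0012 claim key, series status DISPUTED —
two kernel facts about the cell's OWN typing `FrobenioidBridgeModelsEx54ivInfKappa.lean`; nothing of the series is
asserted and no side is taken on [IUTchIII] Cor. 3.12).

* `exists_infKappaLink_ex54ivInfKappaCompat` — over EVERY stub `S : S5Local 𝔡` the hypothesis structure
  `S.InfKappaLink` and the claim `Ex54ivInfKappaCompat` are JOINTLY inhabited (all groups and pseudo-monoids
  trivial, restriction = identity, `ratHom` = identity) «[model: trivial coric data, labelled]»: the binder set of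
  the typed clause is satisfiable (abc-iut-L5-lead TOKEN STANDARD (b)-style consistency; it witnesses OUR binders
  only).
* `not_forall_ex54ivInfKappaCompat` — over every stub the universal closure `∀ L, Ex54ivInfKappaCompat L` is
  FALSE (a link whose «restriction of Kummer classes» misses `‡𝕄_{∞κv} := ∅`): the clause is a genuine condition
  on the (m5) data `resKummer`/`ratHom`, decided only at a GENUINE carrier (GAP G-L5t9g8-1) — schema-level, says
  nothing about print.

PROOF-ONLY: no `def`, no `instance`, no notation, no `Prop` fact; axioms ⊆ {propext, Classical.choice, Quot.sound};
typed ≠ inhabited ≠ proved; nothing here asserts that abc is proved or refuted.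
-/

namespace Literature.IUT.HodgeTheaters

open CategoryTheory

universe u

namespace BaseThetaDatum

variable {𝔡 : BaseThetaDatum.{u}}

namespace S5Local

/-- **NON-VACUITY / CONSISTENCY**: over every stub there is an `∞κ`-link at which the Ex 5.4 (iv)
`∞κ`-compatibility clause HOLDS (trivial groups and pseudo-monoids; restriction and `ratHom` the identities)
«[model: trivial coric data, labelled]». ([IUTchI] Ex 5.4 (iv) p.149) [claim: Mochizuki2012, status: disputed] -/
theorem exists_infKappaLink_ex54ivInfKappaCompat (S : S5Local 𝔡) :
    ∃ L : S.InfKappaLink, Ex54ivInfKappaCompat L := by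
  let triv : CoricPair PUnit.{u+1} :=
    { carrier := PUnit.{u+1}
      pm := ⟨Set.univ, fun _ => PUnit.unit⟩
      isOpen_stabilizer := fun _ => isOpen_discrete _
      smul_dom := fun _ _ => Iff.rfl
      smul_op := fun _ _ => rfl }
  refine ⟨{ globRat := fun _ => PUnit.{u+1}
            globInfk := fun _ => triv
            locRat := fun _ _ => PUnit.{u+1}
            locInfkx := fun _ _ => triv
            locInfk := fun _ _ => ⊤
            resKummer := fun _ _ _ _ m => m
            ratHom := fun _ _ _ _ => ContinuousMonoidHom.id _ }, ?_⟩
  intro X Y Z d δ v f _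
  exact ⟨fun _ => trivial, fun _ _ => rfl, fun p => ⟨Set.mem_univ _, rfl⟩⟩

/-- **CONTENT**: over every stub the universal closure of the clause over all `∞κ`-links is FALSE — witness: a
link with `‡𝕄_{∞κv} := ∅` inside a one-point `‡𝕄_{∞κ×v}`, so the restriction of Kummer classes along a member of
the induced `‡𝒟_v → †𝒟^⊚` (which exists: `FPolyHomNF.under_nonempty`, ★ p510882) cannot land in it.  Schema-level
statement about OUR typing; says nothing about print. ([IUTchI] Ex 5.4 (iv) p.149) [claim: Mochizuki2012, status: disputed] -/
theorem not_forall_ex54ivInfKappaCompat (S : S5Local 𝔡) : ¬ ∀ L : S.InfKappaLink, Ex54ivInfKappaCompat L := by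
  intro h
  let triv : CoricPair PUnit.{u+1} :=
    { carrier := PUnit.{u+1}
      pm := ⟨Set.univ, fun _ => PUnit.unit⟩
      isOpen_stabilizer := fun _ => isOpen_discrete _
      smul_dom := fun _ _ => Iff.rfl
      smul_op := fun _ _ => rfl }
  let L : S.InfKappaLink :=
    { globRat := fun _ => PUnit.{u+1}
      globInfk := fun _ => triv
      locRat := fun _ _ => PUnit.{u+1}
      locInfkx := fun _ _ => triv
      locInfk := fun _ _ => ⊥
      resKummer := fun _ _ _ _ m => m
      ratHom := fun _ _ _ _ => ContinuousMonoidHom.id _ }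
  obtain ⟨δ⟩ := FPolyHomNF.nonempty (S := S) S.F S.FG
  obtain ⟨v, -⟩ := 𝔡.exists_isBad
  obtain ⟨f, hf⟩ := FPolyHomNF.under_nonempty δ v
  exact (h L S.F S.FG S.FGlob S.dashModel δ v f hf).1 PUnit.unit

/-- Packaging: the typed clause is SATISFIABLE AND NON-TAUTOLOGICAL over every stub — exactly the profile of an
after-merge obligation (decided by the genuine (m5) carrier, GAP G-L5t9g8-1), not of a vacuous or contradictory
schema. ([IUTchI] Ex 5.4 (iv) p.149) [claim: Mochizuki2012, status: disputed] -/
theorem ex54ivInfKappaCompat_satisfiable_and_not_forall (S : S5Local 𝔡) :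
    (∃ L : S.InfKappaLink, Ex54ivInfKappaCompat L) ∧ ¬ ∀ L : S.InfKappaLink, Ex54ivInfKappaCompat L :=
  ⟨exists_infKappaLink_ex54ivInfKappaCompat S, not_forall_ex54ivInfKappaCompat S⟩

end S5Local

end BaseThetaDatum

end Literature.IUT.HodgeTheaters
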